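import Mathlib.LinearAlgebra.Dimension.Constructions
import Mathlib.LinearAlgebra.Dimension.Finite
import Mathlib.LinearAlgebra.FiniteDimensional.Lemmas
import HarnessLib

/-!
# Rado's theorem on independent transversals, for vector spaces

For a finite family `A : ι → Finset W` of finite sets of vectors of a vector space `W` over a
field `K`, an *independent transversal* is a choice `e j ∈ A j` of one vector per index such that
the family `e` is linearly independent. **Rado's theorem** (Rado 1942, Thm 1, for the linear
matroid; the general matroid form is in Welsh, *Matroid Theory* (1976), Ch. 7 §2, and Oxley,
*Matroid Theory*, 2nd ed., Thm 11.2.2): an independent transversal exists iff every subfamily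
`s ⊆ ι` spans a subspace of dimension at least `|s|` — the "Hall condition with rank in place of
cardinality". We prove the sufficiency direction `rado_vector_space` by Welsh's deletion
argument (strong induction on `∑ j, |A j|`: if some `A j₀` has two elements, one of them can be
deleted keeping the rank condition — `rado_delete`, a submodularity computation — and a family
of singletons satisfying the rank condition is linearly independent — `rado_small`), and record
the trivial necessity direction `rado_necessity`.

The rank function is `s ↦ finrank K (span K (⋃_{j ∈ s} A j))`, written with `Finset.biUnion`.
Mathlib (this pin) has Hall's marriage theorem (`Mathlib.Combinatorics.Hall.Basic`) and the
abstract `Matroid`, but no Rado / independent-transversal theorem; nothing here is specific to a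
field beyond `finrank` of spans (`finrank_span_finset_le_card`, `finrank_span_eq_card`).

Used by: the linear Aharoni–Linial lemma behind the Res(⊕) rank lower bound
`Summit.PneNP.PneNP.Theses.ReslinSizeFromWidth.WidthFromVertexExpansion` (Summits side).

-- adapted from reserve/prior-2001/Prior/PneNP/PneNP/Pnp_Ac0pFregeViaAlgebraicProofs_SafeWalkLAL.lean
-- (2001 programme, Section 4 "Rado's theorem for vector spaces"); proofs unchanged, docstrings added.

## References

* R. Rado, *A theorem on independence relations*, Quart. J. Math. Oxford 13 (1942) 83–89, Thm 1.
* D. J. A. Welsh, *Matroid Theory*, Academic Press 1976, Ch. 7 §2 (Rado's theorem; deletion proof).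
-/

namespace Literature.Combinatorics.Matroid

open Finset Submodule Module

section Rado

variable {K : Type*} [Field K] {W : Type*} [AddCommGroup W] [Module K W] [DecidableEq W]

/-- A finite family of vectors all of whose finite subfamilies `s` span a space of dimension
`≥ |s|` is linearly independent (the endgame of the deletion argument: an admissible family of
singletons is an independent transversal). [Welsh 1976, Ch. 7 §2; Rado 1942, Thm 1]
[cite: Rado1942, Thm 1] -/
theorem linearIndependent_of_forall_card_le_finrank_span
    {ι : Type*} [Fintype ι] [DecidableEq ι] (e : ι → W)
    (h : ∀ s : Finset ι,
      s.card ≤ finrank K (Submodule.span K ((s.image e : Finset W) : Set W))) :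
    LinearIndependent K e := by
  classical
  rw [Fintype.linearIndependent_iff]
  intro g hg
  by_contra hne
  push Not at hne
  obtain ⟨j₀, hj₀⟩ := hne
  set s : Finset ι := Finset.univ.filter (fun i => g i ≠ 0) with hs
  have hj₀s : j₀ ∈ s := by simp [hs, hj₀]
  have hsum : ∑ i ∈ s, g i • e i = 0 := by
    have hsub : ∑ i ∈ s, g i • e i = ∑ i, g i • e i :=
      Finset.sum_subset (Finset.subset_univ s) (fun i _ hi => by
        have hgi : g i = 0 := by
          by_contra hne2
          exact hi (by simp [hs, hne2])
        simp [hgi])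
    rw [hsub, hg]
  have hsplit : g j₀ • e j₀ + ∑ i ∈ s.erase j₀, g i • e i = 0 :=
    (Finset.add_sum_erase s (fun i => g i • e i) hj₀s).trans hsum
  have hmem : e j₀ ∈
      Submodule.span K (((s.erase j₀).image e : Finset W) : Set W) := by
    have h1 : g j₀ • e j₀ = - ∑ i ∈ s.erase j₀, g i • e i :=
      eq_neg_of_add_eq_zero_left hsplit
    have h2 : e j₀ = (g j₀)⁻¹ • (g j₀ • e j₀) := by
      rw [smul_smul, inv_mul_cancel₀ hj₀, one_smul]
    rw [h2, h1]
    refine Submodule.smul_mem _ _ (Submodule.neg_mem _ (Submodule.sum_mem _ ?_))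
    intro i hi
    refine Submodule.smul_mem _ _ (Submodule.subset_span ?_)
    rw [Finset.coe_image]
    exact Set.mem_image_of_mem _ (Finset.mem_coe.mpr hi)
  have hspan : Submodule.span K ((s.image e : Finset W) : Set W) =
      Submodule.span K (((s.erase j₀).image e : Finset W) : Set W) := by
    have himg : s.image e = insert (e j₀) ((s.erase j₀).image e) := by
      conv_lhs => rw [← Finset.insert_erase hj₀s]
      rw [Finset.image_insert]
    rw [himg, Finset.coe_insert, Submodule.span_insert_eq_span hmem]
  have hcard := h s
  rw [hspan] at hcard
  have hle : finrank K (Submodule.span K (((s.erase j₀).image e : Finset W) : Set W)) ≤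
      ((s.erase j₀).image e).card := finrank_span_finset_le_card _
  have hle2 : ((s.erase j₀).image e).card ≤ (s.erase j₀).card := Finset.card_image_le
  have herase : (s.erase j₀).card = s.card - 1 := Finset.card_erase_of_mem hj₀s
  have hpos : 1 ≤ s.card := Finset.card_pos.mpr ⟨j₀, hj₀s⟩
  omega

/-- **Rado's theorem, necessity** (trivial direction): if the family `A` has an independent
transversal `e`, then every subfamily `s` spans a space of dimension at least `|s|`.
[Rado 1942, Thm 1] [cite: Rado1942, Thm 1] -/
theorem rado_necessity {ι : Type*} [Fintype ι] [DecidableEq ι]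
    (A : ι → Finset W) (e : ι → W) (he : ∀ j, e j ∈ A j)
    (hli : LinearIndependent K e) (s : Finset ι) :
    s.card ≤ finrank K (Submodule.span K ((s.biUnion A : Finset W) : Set W)) := by
  classical
  have hli' : LinearIndependent K (fun j : {x // x ∈ s} => e j.1) :=
    hli.comp _ Subtype.val_injective
  have hrank : finrank K (Submodule.span K (Set.range (fun j : {x // x ∈ s} => e j.1))) =
      Fintype.card {x // x ∈ s} := finrank_span_eq_card hli'
  have hsub : Submodule.span K (Set.range (fun j : {x // x ∈ s} => e j.1)) ≤
      Submodule.span K ((s.biUnion A : Finset W) : Set W) := by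
    apply Submodule.span_mono
    rintro x ⟨j, rfl⟩
    rw [Finset.mem_coe, Finset.mem_biUnion]
    exact ⟨j.1, j.2, he j.1⟩
  have := Submodule.finrank_mono hsub
  rw [hrank, Fintype.card_coe] at this
  exact this

/-- The singleton endgame of the deletion argument: a family satisfying the rank condition all of
whose parts have at most one element consists of singletons, and the chosen elements are linearly
independent. [Welsh 1976, Ch. 7 §2] [cite: Rado1942, Thm 1] -/
private theorem rado_small {ι : Type*} [Fintype ι] [DecidableEq ι] (A : ι → Finset W)
    (adm : ∀ s : Finset ι,
      s.card ≤ finrank K (Submodule.span K ((s.biUnion A : Finset W) : Set W)))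
    (hsmall : ∀ j, (A j).card ≤ 1) :
    ∃ e : ι → W, (∀ j, e j ∈ A j) ∧ LinearIndependent K e := by
  classical
  cases isEmpty_or_nonempty ι with
  | inl hempty =>
    exact ⟨fun j => (hempty.false j).elim, fun j => (hempty.false j).elim,
      linearIndependent_empty_type⟩
  | inr hne =>
    have hone : ∀ j, ∃ x, A j = {x} := by
      intro j
      have h1 := adm {j}
      rw [Finset.card_singleton, Finset.singleton_biUnion] at h1
      have hnonempty : (A j).Nonempty := by
        by_contra hemp
        rw [Finset.not_nonempty_iff_eq_empty] at hemp
        rw [hemp] at h1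
        simp at h1
      rw [← Finset.card_eq_one]
      have h2 := hsmall j
      have h3 := Finset.card_pos.mpr hnonempty
      omega
    choose x hx using hone
    refine ⟨x, fun j => by rw [hx j]; exact Finset.mem_singleton_self _, ?_⟩
    apply linearIndependent_of_forall_card_le_finrank_span
    intro s
    have himg : s.image x = s.biUnion A := by
      ext w
      simp only [Finset.mem_image, Finset.mem_biUnion]
      constructor
      · rintro ⟨j, hj, rfl⟩
        exact ⟨j, hj, by rw [hx j]; exact Finset.mem_singleton_self _⟩
      · rintro ⟨j, hj, hw⟩
        rw [hx j, Finset.mem_singleton] at hw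
        exact ⟨j, hj, hw.symm⟩
    rw [himg]
    exact adm s

/-- Submodularity of the span rank of finite sets of vectors:
`rk(X₁ ∪ X₂) + rk(X₁ ∩ X₂) ≤ rk X₁ + rk X₂`. [folklore] -/
private theorem finrank_span_union_add_inter_le (X₁ X₂ : Finset W) :
    finrank K (Submodule.span K ((X₁ ∪ X₂ : Finset W) : Set W)) +
      finrank K (Submodule.span K ((X₁ ∩ X₂ : Finset W) : Set W)) ≤
    finrank K (Submodule.span K ((X₁ : Finset W) : Set W)) +
      finrank K (Submodule.span K ((X₂ : Finset W) : Set W)) := by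
  have hsup : Submodule.span K ((X₁ ∪ X₂ : Finset W) : Set W) =
      Submodule.span K (X₁ : Set W) ⊔ Submodule.span K (X₂ : Set W) := by
    rw [Finset.coe_union, Submodule.span_union]
  have hinf : Submodule.span K ((X₁ ∩ X₂ : Finset W) : Set W) ≤
      Submodule.span K (X₁ : Set W) ⊓ Submodule.span K (X₂ : Set W) := by
    refine le_inf_iff.mpr ⟨Submodule.span_mono ?_, Submodule.span_mono ?_⟩
    · rw [Finset.coe_inter]; exact Set.inter_subset_left
    · rw [Finset.coe_inter]; exact Set.inter_subset_right
  have h := Submodule.finrank_sup_add_finrank_inf_eq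
    (Submodule.span K (X₁ : Set W)) (Submodule.span K (X₂ : Set W))
  have hm := Submodule.finrank_mono hinf
  have hs : finrank K (Submodule.span K ((X₁ ∪ X₂ : Finset W) : Set W)) =
      finrank K (Submodule.span K (X₁ : Set W) ⊔ Submodule.span K (X₂ : Set W) :
        Submodule K W) := by rw [hsup]
  omega

/-- The deletion step of Welsh's argument: if `A j₀` has two distinct elements, deleting one of
them preserves the rank condition. [Welsh 1976, Ch. 7 §2] [cite: Rado1942, Thm 1] -/
private theorem rado_delete {ι : Type*} [Fintype ι] [DecidableEq ι] (A : ι → Finset W)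
    (adm : ∀ s : Finset ι,
      s.card ≤ finrank K (Submodule.span K ((s.biUnion A : Finset W) : Set W)))
    {j₀ : ι} (e₁ : W) (_he₁ : e₁ ∈ A j₀) (e₂ : W) (_he₂ : e₂ ∈ A j₀) (hne : e₁ ≠ e₂) :
    (∀ s : Finset ι, s.card ≤ finrank K (Submodule.span K
        ((s.biUnion (Function.update A j₀ ((A j₀).erase e₁)) : Finset W) : Set W))) ∨
    (∀ s : Finset ι, s.card ≤ finrank K (Submodule.span K
        ((s.biUnion (Function.update A j₀ ((A j₀).erase e₂)) : Finset W) : Set W))) := by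
  classical
  by_contra hcon
  push Not at hcon
  obtain ⟨⟨s₁, hs₁⟩, ⟨s₂, hs₂⟩⟩ := hcon
  -- j₀ must lie in each violating set
  have hj₀mem : ∀ (x : W) (s : Finset ι),
      finrank K (Submodule.span K
        ((s.biUnion (Function.update A j₀ ((A j₀).erase x)) : Finset W) : Set W)) < s.card →
      j₀ ∈ s := by
    intro x s hlt
    by_contra hj
    have hcong : s.biUnion (Function.update A j₀ ((A j₀).erase x)) = s.biUnion A :=
      Finset.biUnion_congr rfl
        (fun j hj' => Function.update_of_ne (fun h => hj (by rw [← h]; exact hj')) _ _)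
    rw [hcong] at hlt
    exact absurd (adm s) (not_le.mpr hlt)
  have hj₀s₁ : j₀ ∈ s₁ := hj₀mem e₁ s₁ hs₁
  have hj₀s₂ : j₀ ∈ s₂ := hj₀mem e₂ s₂ hs₂
  -- rewrite the two biUnions in the explicit form (A j₀ \ eᵢ) ∪ (Kᵢ.biUnion A)
  have hXeq : ∀ (x : W) (s : Finset ι), j₀ ∈ s →
      s.biUnion (Function.update A j₀ ((A j₀).erase x)) =
        ((A j₀).erase x) ∪ (s.erase j₀).biUnion A := by
    intro x s hj₀s
    conv_lhs => rw [← Finset.insert_erase hj₀s]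
    rw [Finset.biUnion_insert]
    congr 1
    · exact Function.update_self _ _ _
    · exact Finset.biUnion_congr rfl
        (fun j hj => Function.update_of_ne (Finset.ne_of_mem_erase hj) _ _)
  rw [hXeq e₁ s₁ hj₀s₁] at hs₁
  rw [hXeq e₂ s₂ hj₀s₂] at hs₂
  -- the union of the two deleted families is the full family over insert j₀ (K₁ ∪ K₂)
  have hunion : (((A j₀).erase e₁) ∪ (s₁.erase j₀).biUnion A) ∪
      (((A j₀).erase e₂) ∪ (s₂.erase j₀).biUnion A) =
      (insert j₀ ((s₁.erase j₀) ∪ (s₂.erase j₀))).biUnion A := by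
    rw [Finset.biUnion_insert]
    ext w
    constructor
    · intro hw
      rcases Finset.mem_union.mp hw with hw | hw
      · rcases Finset.mem_union.mp hw with hw | hw
        · exact Finset.mem_union_left _ (Finset.mem_of_mem_erase hw)
        · obtain ⟨j, hj, hwj⟩ := Finset.mem_biUnion.mp hw
          exact Finset.mem_union_right _
            (Finset.mem_biUnion.mpr ⟨j, Finset.mem_union_left _ hj, hwj⟩)
      · rcases Finset.mem_union.mp hw with hw | hw
        · exact Finset.mem_union_left _ (Finset.mem_of_mem_erase hw)
        · obtain ⟨j, hj, hwj⟩ := Finset.mem_biUnion.mp hw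
          exact Finset.mem_union_right _
            (Finset.mem_biUnion.mpr ⟨j, Finset.mem_union_right _ hj, hwj⟩)
    · intro hw
      rcases Finset.mem_union.mp hw with hw | hw
      · by_cases hwe : w = e₁
        · refine Finset.mem_union_right _ (Finset.mem_union_left _ ?_)
          exact Finset.mem_erase.mpr ⟨by rw [hwe]; exact hne, hw⟩
        · exact Finset.mem_union_left _
            (Finset.mem_union_left _ (Finset.mem_erase.mpr ⟨hwe, hw⟩))
      · obtain ⟨j, hj, hwj⟩ := Finset.mem_biUnion.mp hw
        rcases Finset.mem_union.mp hj with hj | hj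
        · exact Finset.mem_union_left _
            (Finset.mem_union_right _ (Finset.mem_biUnion.mpr ⟨j, hj, hwj⟩))
        · exact Finset.mem_union_right _
            (Finset.mem_union_right _ (Finset.mem_biUnion.mpr ⟨j, hj, hwj⟩))
  -- the intersection contains the family over K₁ ∩ K₂
  have hinter : ((s₁.erase j₀) ∩ (s₂.erase j₀)).biUnion A ⊆
      (((A j₀).erase e₁) ∪ (s₁.erase j₀).biUnion A) ∩
        (((A j₀).erase e₂) ∪ (s₂.erase j₀).biUnion A) := by
    intro w hw
    obtain ⟨j, hj, hwj⟩ := Finset.mem_biUnion.mp hw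
    rw [Finset.mem_inter] at hj
    exact Finset.mem_inter.mpr
      ⟨Finset.mem_union_right _ (Finset.mem_biUnion.mpr ⟨j, hj.1, hwj⟩),
       Finset.mem_union_right _ (Finset.mem_biUnion.mpr ⟨j, hj.2, hwj⟩)⟩
  -- assemble the submodular contradiction
  have hj₀K : j₀ ∉ (s₁.erase j₀) ∪ (s₂.erase j₀) := by
    intro h
    rcases Finset.mem_union.mp h with h | h
    · exact (Finset.mem_erase.mp h).1 rfl
    · exact (Finset.mem_erase.mp h).1 rfl
  have hadm_union := adm (insert j₀ ((s₁.erase j₀) ∪ (s₂.erase j₀)))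
  rw [← hunion] at hadm_union
  rw [Finset.card_insert_of_notMem hj₀K] at hadm_union
  have hspanle : Submodule.span K
        ((((s₁.erase j₀) ∩ (s₂.erase j₀)).biUnion A : Finset W) : Set W) ≤
      Submodule.span K
        (((((A j₀).erase e₁) ∪ (s₁.erase j₀).biUnion A) ∩
          (((A j₀).erase e₂) ∪ (s₂.erase j₀).biUnion A) : Finset W) : Set W) :=
    Submodule.span_mono (Finset.coe_subset.mpr hinter)
  have hadm_inter :
      ((s₁.erase j₀) ∩ (s₂.erase j₀)).card ≤
        finrank K (Submodule.span K
          (((((A j₀).erase e₁) ∪ (s₁.erase j₀).biUnion A) ∩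
            (((A j₀).erase e₂) ∪ (s₂.erase j₀).biUnion A) : Finset W) : Set W)) :=
    le_trans (adm _) (Submodule.finrank_mono (R := K) hspanle)
  have hsubmod := finrank_span_union_add_inter_le (K := K)
    (((A j₀).erase e₁) ∪ (s₁.erase j₀).biUnion A)
    (((A j₀).erase e₂) ∪ (s₂.erase j₀).biUnion A)
  have hcards := Finset.card_union_add_card_inter (s₁.erase j₀) (s₂.erase j₀)
  have hc₁ : (s₁.erase j₀).card = s₁.card - 1 := Finset.card_erase_of_mem hj₀s₁
  have hc₂ : (s₂.erase j₀).card = s₂.card - 1 := Finset.card_erase_of_mem hj₀s₂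
  have hp₁ : 1 ≤ s₁.card := Finset.card_pos.mpr ⟨j₀, hj₀s₁⟩
  have hp₂ : 1 ≤ s₂.card := Finset.card_pos.mpr ⟨j₀, hj₀s₂⟩
  omega

/-- Sufficiency in Rado's theorem, by Welsh's deletion argument: strong induction on the total
size `∑ j, |A j|` of the family. [Welsh 1976, Ch. 7 §2] [cite: Rado1942, Thm 1] -/
private theorem rado_aux {ι : Type*} [Fintype ι] [DecidableEq ι] :
    ∀ (N : ℕ) (A : ι → Finset W), (∑ j, (A j).card ≤ N) →
      (∀ s : Finset ι,
        s.card ≤ finrank K (Submodule.span K ((s.biUnion A : Finset W) : Set W))) →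
      ∃ e : ι → W, (∀ j, e j ∈ A j) ∧ LinearIndependent K e := by
  intro N
  induction N with
  | zero =>
    intro A hsize adm
    exact rado_small A adm (fun j => by
      have : (A j).card = 0 := by
        have := Finset.single_le_sum (f := fun j => (A j).card)
          (fun i _ => Nat.zero_le _) (Finset.mem_univ j)
        omega
      omega)
  | succ N ihN =>
    intro A hsize adm
    by_cases hsmall : ∀ j, (A j).card ≤ 1
    · exact rado_small A adm hsmall
    · push Not at hsmall
      obtain ⟨j₀, hj₀⟩ := hsmall
      obtain ⟨e₁, he₁, e₂, he₂, hne⟩ := Finset.one_lt_card.mp hj₀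
      have key : (∀ s : Finset ι, s.card ≤ finrank K (Submodule.span K
            ((s.biUnion (Function.update A j₀ ((A j₀).erase e₁)) : Finset W) : Set W))) ∨
          (∀ s : Finset ι, s.card ≤ finrank K (Submodule.span K
            ((s.biUnion (Function.update A j₀ ((A j₀).erase e₂)) : Finset W) : Set W))) :=
        rado_delete A adm e₁ he₁ e₂ he₂ hne
      have hstep : ∀ x ∈ A j₀, ∀ (_ : ∀ s : Finset ι, s.card ≤
            finrank K (Submodule.span K
              ((s.biUnion (Function.update A j₀ ((A j₀).erase x)) : Finset W) : Set W))),
          ∃ e : ι → W, (∀ j, e j ∈ A j) ∧ LinearIndependent K e := by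
        intro x hx hadm
        set A' := Function.update A j₀ ((A j₀).erase x) with hA'
        have hsize' : ∑ j, (A' j).card ≤ N := by
          have hupd0 : (A' j₀).card + ∑ j ∈ Finset.univ.erase j₀, (A' j).card =
              ∑ j, (A' j).card :=
            Finset.add_sum_erase _ (fun j => (A' j).card) (Finset.mem_univ j₀)
          have hself : A' j₀ = (A j₀).erase x := by rw [hA', Function.update_self]
          have hcongr : ∑ j ∈ Finset.univ.erase j₀, (A' j).card =
              ∑ j ∈ Finset.univ.erase j₀, (A j).card :=
            Finset.sum_congr rfl (fun j hj => by
              rw [hA', Function.update_of_ne (Finset.ne_of_mem_erase hj)])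
          have hold : (A j₀).card + ∑ j ∈ Finset.univ.erase j₀, (A j).card =
              ∑ j, (A j).card :=
            Finset.add_sum_erase _ (fun j => (A j).card) (Finset.mem_univ j₀)
          have hxc : ((A j₀).erase x).card = (A j₀).card - 1 :=
            Finset.card_erase_of_mem hx
          have hpos : 1 ≤ (A j₀).card := Finset.card_pos.mpr ⟨x, hx⟩
          rw [hself] at hupd0
          rw [hcongr] at hupd0
          omega
        obtain ⟨e, he, hli⟩ := ihN A' hsize' hadm
        refine ⟨e, fun j => ?_, hli⟩
        by_cases hj : j = j₀
        · subst hj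
          have := he j
          rw [hA', Function.update_self] at this
          exact Finset.erase_subset _ _ this
        · have := he j
          rwa [hA', Function.update_of_ne hj] at this
      rcases key with hadm | hadm
      · exact hstep e₁ he₁ hadm
      · exact hstep e₂ he₂ hadm

/-- **Rado's theorem for vector spaces** (sufficiency): if every subfamily `s` of the finite
family `A : ι → Finset W` spans a subspace of dimension at least `|s|`, then `A` has a linearly
independent transversal `e j ∈ A j`. Together with `rado_necessity` this is Rado's 1942
criterion for the linear matroid. [Rado 1942, Thm 1; Welsh 1976, Ch. 7 §2] [cite: Rado1942, Thm 1] -/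
theorem rado_vector_space {ι : Type*} [Fintype ι] [DecidableEq ι] (A : ι → Finset W)
    (adm : ∀ s : Finset ι,
      s.card ≤ finrank K (Submodule.span K ((s.biUnion A : Finset W) : Set W))) :
    ∃ e : ι → W, (∀ j, e j ∈ A j) ∧ LinearIndependent K e :=
  rado_aux (K := K) (∑ j, (A j).card) A le_rfl adm

/-- Rado's theorem for vector spaces as an `iff`. [Rado 1942, Thm 1] [cite: Rado1942, Thm 1] -/
theorem rado_vector_space_iff {ι : Type*} [Fintype ι] [DecidableEq ι] (A : ι → Finset W) :
    (∃ e : ι → W, (∀ j, e j ∈ A j) ∧ LinearIndependent K e) ↔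
      ∀ s : Finset ι,
        s.card ≤ finrank K (Submodule.span K ((s.biUnion A : Finset W) : Set W)) :=
  ⟨fun ⟨e, he, hli⟩ s => rado_necessity A e he hli s, rado_vector_space A⟩

end Rado

end Literature.Combinatorics.Matroid
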